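import Summits.QuantumFields.YangMills.Theorems.BalabanLadderNTStrongCouplingInfluence
import Literature.MathematicalPhysics.QuantumFieldTheory.WilsonFinTorusPeriodicLift
import HarnessLib

/-!
# Crux `IR` (stmt-QuantumFields-19354), cold-purity currency: the one-point torus-size difference of the plaquette
# density inside the total-variation DOBRUSHIN DOOR (every compact group) — window bookkeeping and time covering

Helper file (`--supports stmt-QuantumFields-19354`, helper class; no registered stub is claimed) of the pooled IR prover
`ym-ir-line-pool-p3` (g6), first half of the assembly «J-A′ = D1 + assembly» of the ideator note
`Cruxes/IR/PURITY-CORNER-TRANSPORT-idea3g13.md` (FINITE-BOX-PURITY §9 row (i-f)).  The brick D1 — the anisotropic-torus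
periodic lift and the local DLR equations of the torus Wilson state read in a `ℤ⁴` window — is the Literature module
`WilsonFinTorusPeriodicLift` (`finTorusExpectation_finTorusLift_eq_kernel`, `abs_finTorusExpectation_lift_sub_lift_le`).
Here:

* §1 `abs_plaquetteActionObs_sub_le_of_dobrushin` — for a lattice representation `r` (dimension `N`) of a compact
  metrisable `G` and `216 · N · |β| ≤ 1` (the tree's every-group total-variation Dobrushin door,
  `NT.StrongCoupling.abs_kerInt_sub_le_of_agree_ball`, Georgii 2011 Thm. 8.20 with the profile super-solution `2^{−ℓ}`):
  the Wilson expectations of the plaquette action density `N − Re tr ρ(U_p)` on two tori `L³ × T₁`, `L³ × T₂` at the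
  projections of one `ℤ⁴` plaquette differ by at most `8N · 2^{−m}` as soon as `2m + 2 < L, T₁, T₂` (window = links
  within sup-distance `m` of the plaquette; its plaquette closure injects into both tori, `injOn_windowClosure`);
* §2 `finTorusExpectation_action_eq_sum` (the action expectation is the sum of the `6 · L³T` one-plaquette
  expectations) and `sum_comp_timeDouble` (the `2 : 1` time covering `L³ × 2t → L³ × t`, site by site through the
  canonical representative: every site of the short torus has exactly two preimages).

The second half (`BalabanLadderIRColdPurityDobrushinCorner.lean`) integrates the coupling derivative of
`F = −log(1 − δᶜ)` and concludes `δᶜ_β(L) ≤ (4/9) L³⌊L/4⌋ 2^{−⌊(⌊L/4⌋−3)/2⌋}` at the door, every `L ≥ 20`.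

HONEST FRAMING.  Strong-coupling (high-temperature) FORMAT statements, every compact metrisable `G`, every lattice
representation — the opposite corner to the weak-coupling content of `ColdExitAt` / `BalabanLadder.IR`; nothing here
proves a lattice mass gap, `BalabanLadder.IR` (0/1) or the Yang–Mills mass gap (Clay); R4 closes only the conditional
finite-𝕋⁴ rung `BalabanLadder.UV`.

References: H.-O. Georgii, *Gibbs Measures and Phase Transitions* (2011) Thm. 8.20, Remark 8.26; R. L. Dobrushin,
Theory Probab. Appl. 15 (1970) 458; I. Montvay, G. Münster, *Quantum Fields on a Lattice* (1994) §3.2.6.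
-/

set_option autoImplicit false

noncomputable section

namespace Summit.QuantumFields.YangMills.Cruxes.IR.ColdPurityDobrushin

open MeasureTheory Filter Topology Finset
open Literature.MathematicalPhysics.QuantumFieldTheory hiding ZdEdge
open Literature.MathematicalPhysics.QuantumLattice
open Summit.QuantumFields.YangMills.Cruxes.NT.StrongCoupling (abs_kerInt_sub_le_of_agree_ball)

/-! ## §1 One-point torus-size difference inside the Dobrushin door -/

section OnePoint

variable {G : Type} [Group G] [TopologicalSpace G] [IsTopologicalGroup G] [CompactSpace G]
  [MeasurableSpace G] [BorelSpace G]

/-- Base points of the links of a plaquette based at `v` lie in `v + [0,1]⁴`. -/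
theorem coord_bounds_of_mem_plaquetteEdges (p : ZdPlaquette 4) {z : Literature.MathematicalPhysics.QuantumLattice.ZdEdge 4}
    (hz : z ∈ plaquetteEdges p) (k : Fin 4) : p.1 k ≤ z.1 k ∧ z.1 k ≤ p.1 k + 1 := by
  have hsingle : ∀ i : Fin 4, (p.1 + Pi.single i (1 : ℤ) : Fin 4 → ℤ) k = p.1 k + if k = i then 1 else 0 := by
    intro i
    simp only [Pi.add_apply, Pi.single_apply]
  simp only [plaquetteEdges, Finset.mem_insert, Finset.mem_singleton] at hz
  rcases hz with rfl | rfl | rfl | rfl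
  · constructor <;> dsimp only <;> omega
  · show p.1 k ≤ (p.1 + Pi.single _ (1 : ℤ) : Fin 4 → ℤ) k ∧ (p.1 + Pi.single _ (1 : ℤ) : Fin 4 → ℤ) k ≤ p.1 k + 1
    rw [hsingle]; constructor <;> split_ifs <;> omega
  · show p.1 k ≤ (p.1 + Pi.single _ (1 : ℤ) : Fin 4 → ℤ) k ∧ (p.1 + Pi.single _ (1 : ℤ) : Fin 4 → ℤ) k ≤ p.1 k + 1
    rw [hsingle]; constructor <;> split_ifs <;> omega
  · constructor <;> dsimp only <;> omega

/-- A link whose base point is within sup-distance `m` (integer part) of `y` lies in the window of links based in the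
cube `y + [−m, m]⁴`. -/
theorem mem_window_of_floor_norm_le (y : Fin 4 → ℤ) (m : ℕ) {Λ : Finset (Literature.MathematicalPhysics.QuantumLattice.ZdEdge 4)}
    (hΛ : Λ = (Fintype.piFinset fun k => Finset.Icc (y k - m) (y k + m)) ×ˢ (Finset.univ : Finset (Fin 4)))
    {z : Literature.MathematicalPhysics.QuantumLattice.ZdEdge 4} (hle : ⌊‖z.1 - y‖⌋₊ ≤ m) : z ∈ Λ := by
  rw [hΛ, Finset.mem_product]
  refine ⟨Fintype.mem_piFinset.2 fun k => Finset.mem_Icc.2 ?_, Finset.mem_univ _⟩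
  have h1 : ‖z.1 - y‖ < m + 1 := by
    have := Nat.lt_floor_add_one ‖z.1 - y‖
    have h2 : ((⌊‖z.1 - y‖⌋₊ : ℕ) : ℝ) + 1 ≤ m + 1 := by exact_mod_cast Nat.add_le_add_right hle 1
    linarith
  have h3 : |((z.1 k - y k : ℤ) : ℝ)| < m + 1 := by
    have h4 : ‖(z.1 - y) k‖ ≤ ‖z.1 - y‖ := norm_le_pi_norm _ k
    rw [Pi.sub_apply, Int.norm_eq_abs] at h4
    exact lt_of_le_of_lt h4 h1
  have h5 : |z.1 k - y k| ≤ m := by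
    have : |z.1 k - y k| < (m : ℤ) + 1 := by exact_mod_cast h3
    omega
  rw [abs_le] at h5
  constructor <;> omega

/-- Coordinates of the base points of `Λ ∪ ∂p ∪ ∂(plaquettes touching Λ)` lie in the cube `y + [−m−1, m+1]⁴`, where
`Λ` is the window of links based in `y + [−m, m]⁴` and `p` is a plaquette based at `y`. -/
theorem coord_bounds_of_mem_windowClosure (y : Fin 4 → ℤ) (m : ℕ) (q : {q : Fin 4 × Fin 4 // q.1 < q.2})
    {Λ : Finset (Literature.MathematicalPhysics.QuantumLattice.ZdEdge 4)}
    (hΛ : Λ = (Fintype.piFinset fun k => Finset.Icc (y k - m) (y k + m)) ×ˢ (Finset.univ : Finset (Fin 4)))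
    {x : Fin 4 → ℤ}
    (hx : x ∈ (Λ ∪ plaquetteEdges ((y, q) : ZdPlaquette 4) ∪ (plaquettesTouching Λ).biUnion plaquetteEdges).image
      Prod.fst) (k : Fin 4) :
    y k - m - 1 ≤ x k ∧ x k ≤ y k + m + 1 := by
  have hwin : ∀ z : Literature.MathematicalPhysics.QuantumLattice.ZdEdge 4, z ∈ Λ →
      y k - m ≤ z.1 k ∧ z.1 k ≤ y k + m := by
    intro z hz
    rw [hΛ] at hz
    have h1 := (Finset.mem_product.1 hz).1
    rw [Fintype.mem_piFinset] at h1
    exact Finset.mem_Icc.1 (h1 k)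
  obtain ⟨z, hz, rfl⟩ := Finset.mem_image.1 hx
  rcases Finset.mem_union.1 hz with hz | hz
  · rcases Finset.mem_union.1 hz with hz | hz
    · have := hwin z hz; constructor <;> omega
    · have := coord_bounds_of_mem_plaquetteEdges (y, q) hz k
      dsimp only at this
      constructor <;> omega
  · obtain ⟨p, hp, hzp⟩ := Finset.mem_biUnion.1 hz
    obtain ⟨e, he⟩ := mem_plaquettesTouching_iff.1 hp
    obtain ⟨he1, he2⟩ := Finset.mem_inter.1 he
    have hwe := hwin e he2
    have hze := coord_bounds_of_mem_plaquetteEdges p hzp k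
    have hpe := coord_bounds_of_mem_plaquetteEdges p he1 k
    constructor <;> omega

/-- The projection `ℤ⁴ → L³ × T` is injective on the base points of the window closure once `2m + 2 < L` and
`2m + 2 < T`. -/
theorem injOn_windowClosure (y : Fin 4 → ℤ) (m : ℕ) (q : {q : Fin 4 × Fin 4 // q.1 < q.2})
    {Λ : Finset (Literature.MathematicalPhysics.QuantumLattice.ZdEdge 4)}
    (hΛ : Λ = (Fintype.piFinset fun k => Finset.Icc (y k - m) (y k + m)) ×ˢ (Finset.univ : Finset (Fin 4)))
    {L T : ℕ} [NeZero L] [NeZero T] (hL : 2 * m + 2 < L) (hT : 2 * m + 2 < T) :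
    Set.InjOn (finTorusProjSite L T)
      ((Λ ∪ plaquetteEdges ((y, q) : ZdPlaquette 4) ∪ (plaquettesTouching Λ).biUnion plaquetteEdges).image
        Prod.fst : Set (Fin 4 → ℤ)) := by
  refine finTorusProjSite_injOn fun x hx x' hx' => ?_
  have b := fun k => coord_bounds_of_mem_windowClosure y m q hΛ (Finset.mem_coe.1 hx) k
  have b' := fun k => coord_bounds_of_mem_windowClosure y m q hΛ (Finset.mem_coe.1 hx') k
  have key : ∀ k, ∀ S : ℕ, 2 * m + 2 < S → |x k - x' k| < S := fun k S hS => by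
    have h1 := b k
    have h2 := b' k
    rw [abs_lt]
    constructor <;> omega
  exact ⟨key 0 L hL, key 1 L hL, key 2 L hL, key 3 T hT⟩

/-- A plaquette has at most four links. -/
theorem card_plaquetteEdges_le (p : ZdPlaquette 4) : (plaquetteEdges p).card ≤ 4 := by
  unfold plaquetteEdges
  exact (Finset.card_insert_le _ _).trans (Nat.succ_le_succ ((Finset.card_insert_le _ _).trans
    (Nat.succ_le_succ ((Finset.card_insert_le _ _).trans (by simp)))))

/-- **Boundary influence on the plaquette action density, every compact group** (`216 · N · |β| ≤ 1`): the kernel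
means of `N − Re tr ρ(U_p)` over the window of links within sup-distance `m` of the base point of `p` differ by at
most `8N · 2^{−m}` between ANY two exteriors (`NT.StrongCoupling.abs_kerInt_sub_le_of_agree_ball` for the centred
density, `|f| ≤ N`, four links at sup-distance `≤ 1`). -/
theorem abs_kernel_plaquetteActionObs_sub_le (r : LatticeRep G) {β : ℝ} (hβ : 216 * (r.N : ℝ) * |β| ≤ 1)
    (p : ZdPlaquette 4) (m : ℕ) {Λ : Finset (Literature.MathematicalPhysics.QuantumLattice.ZdEdge 4)}
    (hΛ : Λ = (Fintype.piFinset fun k => Finset.Icc (p.1 k - m) (p.1 k + m)) ×ˢ (Finset.univ : Finset (Fin 4)))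
    (ω η : LGConfig 4 G) :
    |(∫ U, plaquetteActionObs r.ρ p U ∂(ymSpecification r.ρ β Λ ω)) -
        ∫ U, plaquetteActionObs r.ρ p U ∂(ymSpecification r.ρ β Λ η)| ≤ 8 * r.N * (1 / 2 : ℝ) ^ m := by
  haveI := r.secondCountableTopology
  haveI hω := isProbabilityMeasure_ymSpecification (d := 4) r.ρ r.continuous β Λ ω
  haveI hη := isProbabilityMeasure_ymSpecification (d := 4) r.ρ r.continuous β Λ η
  have hFc := continuous_plaquetteActionObs r.ρ r.continuous p
  have hFb := abs_plaquetteActionObs_le r.ρ r.mem_unitary p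
  -- centring: the kernels are probability measures
  have hcentre : ∀ ξ : LGConfig 4 G, IsProbabilityMeasure (ymSpecification r.ρ β Λ ξ) →
      ∫ U, plaquetteActionObs r.ρ p U ∂(ymSpecification r.ρ β Λ ξ) =
        (∫ U, (plaquetteActionObs r.ρ p U - r.N) ∂(ymSpecification r.ρ β Λ ξ)) + r.N := by
    intro ξ hξ
    rw [integral_sub (integrable_of_bound hFc.aestronglyMeasurable hFb) (integrable_const _), integral_const]
    simp
  rw [hcentre ω hω, hcentre η hη, add_sub_add_right_eq_sub]
  have hfm : Measurable fun U : LGConfig 4 G => plaquetteActionObs r.ρ p U - r.N := hFc.measurable.sub_const _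
  have hdep : DependsOn (fun U : LGConfig 4 G => plaquetteActionObs r.ρ p U - r.N)
      (↑(plaquetteEdges p) : Set (Literature.MathematicalPhysics.QuantumLattice.ZdEdge 4)) :=
    fun U V h => by simp only [isCylinder_plaquetteActionObs r.ρ p h]
  have hM : ∀ U : LGConfig 4 G, |plaquetteActionObs r.ρ p U - r.N| ≤ r.N :=
    abs_plaquetteActionObs_sub_le r.ρ r.mem_unitary p
  have hΔ : ∀ z ∈ plaquetteEdges p, ⌊‖z.1 - p.1‖⌋₊ ≤ 1 := fun z hz =>
    floor_norm_sub_le_one_of_mem_plaquetteEdges hz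
  have hagree : ∀ z, z ∉ Λ → ⌊‖z.1 - p.1‖⌋₊ ≤ m → ω z = η z := fun z hz hle =>
    absurd (mem_window_of_floor_norm_le p.1 m hΛ hle) hz
  have hdoor := abs_kerInt_sub_le_of_agree_ball G r hβ Λ ω η p.1 m hagree hfm hdep hM hΔ
  refine hdoor.trans ?_
  have hcard : ((plaquetteEdges p).card : ℝ) ≤ 4 := by exact_mod_cast card_plaquetteEdges_le p
  have hm : m + 1 - 1 = m := by omega
  rw [hm]
  have hN : (0 : ℝ) ≤ r.N := Nat.cast_nonneg _
  have hp : (0 : ℝ) ≤ (1 / 2 : ℝ) ^ m := by positivity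
  nlinarith [mul_nonneg hN hp]

/-- **One-point torus-size difference inside the total-variation Dobrushin door.**  For a lattice representation `r`
(dimension `N`) of a compact metrisable `G` and `216 · N · |β| ≤ 1`: on two tori `L³ × T₁`, `L³ × T₂` with
`2m + 2 < L, T₁, T₂`, the Wilson expectations of the plaquette action density `N − Re tr ρ(U_p)` at the projections of
one `ℤ⁴` plaquette `p` differ by at most `8N · 2^{−m}` (window = links within sup-distance `m` of the base point of
`p`; local DLR read in `ℤ⁴`, `abs_finTorusExpectation_lift_sub_lift_le`, + `abs_kernel_plaquetteActionObs_sub_le`). -/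
theorem abs_plaquetteActionObs_sub_le_of_dobrushin (r : LatticeRep G) {β : ℝ} (hβ : 216 * (r.N : ℝ) * |β| ≤ 1)
    {L T₁ T₂ : ℕ} [NeZero L] [NeZero T₁] [NeZero T₂] {m : ℕ} (hL : 2 * m + 2 < L) (hT₁ : 2 * m + 2 < T₁)
    (hT₂ : 2 * m + 2 < T₂) (p : ZdPlaquette 4) :
    |finTorusExpectation r.ρ β
          (fun V : FinTorusSite L L L T₁ × Fin 4 → G => plaquetteActionObs r.ρ p (finTorusLift L T₁ V)) -
        finTorusExpectation r.ρ β
          (fun V : FinTorusSite L L L T₂ × Fin 4 → G => plaquetteActionObs r.ρ p (finTorusLift L T₂ V))| ≤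
      8 * r.N * (1 / 2 : ℝ) ^ m := by
  haveI := r.secondCountableTopology
  obtain ⟨Λ, hΛ⟩ : ∃ Λ : Finset (Literature.MathematicalPhysics.QuantumLattice.ZdEdge 4),
      Λ = (Fintype.piFinset fun k => Finset.Icc (p.1 k - m) (p.1 k + m)) ×ˢ (Finset.univ : Finset (Fin 4)) :=
    ⟨_, rfl⟩
  have h := abs_finTorusExpectation_lift_sub_lift_le r.ρ r.continuous β Λ
    (continuous_plaquetteActionObs r.ρ r.continuous p) (abs_plaquetteActionObs_le r.ρ r.mem_unitary p)
    (isCylinder_plaquetteActionObs r.ρ p) (injOn_windowClosure p.1 m p.2 hΛ hL hT₁)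
    (injOn_windowClosure p.1 m p.2 hΛ hL hT₂) (abs_kernel_plaquetteActionObs_sub_le r hβ p m hΛ)
  exact h

end OnePoint

/-! ## §2 The action expectation as a sum of plaquette terms; the `2 : 1` time covering -/

section Sums

variable {G : Type} [Group G] [TopologicalSpace G] [IsTopologicalGroup G] [CompactSpace G]
  [MeasurableSpace G] [BorelSpace G]

/-- **The action expectation is the sum of the one-plaquette expectations**:
`⟨S⟩_{L³×T} = Σ_x Σ_{μ<ν} ⟨N − Re tr ρ(U_{x,μν})⟩_{L³×T}` (linearity). -/
theorem finTorusExpectation_action_eq_sum (r : LatticeRep G) (β : ℝ) (L T : ℕ) :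
    finTorusExpectation r.ρ β (finTorusWilsonAction (n₀ := L) (n₁ := L) (n₂ := L) (n₃ := T) r.ρ) =
      ∑ x : FinTorusSite L L L T, ∑ q : {q : Fin 4 × Fin 4 // q.1 < q.2},
        finTorusExpectation r.ρ β (fun V : FinTorusSite L L L T × Fin 4 → G =>
          (r.N : ℝ) - (r.ρ (finTorusPlaquette V x q.1.1 q.1.2)).trace.re) := by
  haveI := r.secondCountableTopology
  simp only [finTorusExpectation_eq_div, ← Finset.sum_div]
  congr 1
  have hw : Continuous (finTorusTwistedWeight r.ρ β 1 : (FinTorusSite L L L T × Fin 4 → G) → ℝ) :=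
    continuous_finTorusTwistedWeight r.ρ r.continuous β 1
  have hint : ∀ (x : FinTorusSite L L L T) (q : {q : Fin 4 × Fin 4 // q.1 < q.2}),
      Integrable (fun V : FinTorusSite L L L T × Fin 4 → G =>
        ((r.N : ℝ) - (r.ρ (finTorusPlaquette V x q.1.1 q.1.2)).trace.re) * finTorusTwistedWeight r.ρ β 1 V)
        (Measure.pi fun _ : FinTorusSite L L L T × Fin 4 => haarProbability G) := by
    intro x q
    have hc := (continuous_finTorusPlaquetteTerm r.ρ r.continuous ((x, q) : FinTorusSite L L L T ×
      {q : Fin 4 × Fin 4 // q.1 < q.2})).mul hw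
    exact hc.integrable_of_hasCompactSupport
      (IsCompact.of_isClosed_subset isCompact_univ (isClosed_tsupport _) (Set.subset_univ _))
  have h1 : (fun V : FinTorusSite L L L T × Fin 4 → G =>
      finTorusWilsonAction r.ρ V * finTorusTwistedWeight r.ρ β 1 V) =
      fun V => ∑ x : FinTorusSite L L L T, ∑ q : {q : Fin 4 × Fin 4 // q.1 < q.2},
        ((r.N : ℝ) - (r.ρ (finTorusPlaquette V x q.1.1 q.1.2)).trace.re) * finTorusTwistedWeight r.ρ β 1 V := by
    funext V
    simp only [finTorusWilsonAction, Finset.sum_mul]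
  rw [h1, integral_finsetSum _ fun x _ => integrable_finsetSum _ fun q _ => hint x q]
  exact Finset.sum_congr rfl fun x _ => integral_finsetSum _ fun q _ => hint x q

/-- `(k : ZMod n) = ZMod.finEquiv n k` for `k : Fin n`. -/
theorem natCast_val_eq_zmodFinEquiv {n : ℕ} [NeZero n] (k : Fin n) : ((k : ℕ) : ZMod n) = ZMod.finEquiv n k := by
  cases n with
  | zero => exact absurd rfl (NeZero.ne 0)
  | succ n => exact Fin.cast_val_eq_self k

/-- **The `2 : 1` covering in time, site by site**: projecting the canonical representative of a site of the doubled
torus `L³ × 2t` to the torus `L³ × t` keeps the spatial coordinates and reduces the time coordinate mod `t`. -/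
theorem finTorusProjSite_finTorusRepr_double {L t : ℕ} [NeZero L] [NeZero t] [NeZero (2 * t)]
    (x : FinTorusSite L L L (2 * t)) :
    finTorusProjSite L t (finTorusRepr x) =
      (x.1, x.2.1, x.2.2.1, (ZMod.finEquiv t).symm (((x.2.2.2 : ℕ) : ℕ) : ZMod t)) := by
  apply (finTorusSiteEquiv L t).injective
  rw [finTorusSiteEquiv_finTorusProjSite]
  simp [finTorusRepr, natCast_val_eq_zmodFinEquiv, finTorusSiteEquiv]

/-- Summing a function of the residue mod `t` over `Fin (2t)` counts every residue twice. -/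
theorem sum_fin_two_mul_comp {t : ℕ} [NeZero t] (h : Fin t → ℝ) :
    ∑ i : Fin (2 * t), h ((ZMod.finEquiv t).symm ((i : ℕ) : ZMod t)) = 2 * ∑ j : Fin t, h j := by
  rw [Fin.sum_univ_eq_sum_range (fun n : ℕ => h ((ZMod.finEquiv t).symm ((n : ℕ) : ZMod t))) (2 * t), two_mul,
    Finset.sum_range_add]
  have hper : ∀ n : ℕ, h ((ZMod.finEquiv t).symm (((t + n : ℕ) : ℕ) : ZMod t)) =
      h ((ZMod.finEquiv t).symm ((n : ℕ) : ZMod t)) := by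
    intro n; rw [Nat.cast_add, ZMod.natCast_self, zero_add]
  simp only [hper]
  rw [← Fin.sum_univ_eq_sum_range (fun n : ℕ => h ((ZMod.finEquiv t).symm ((n : ℕ) : ZMod t))) t]
  have hj : ∀ j : Fin t, (ZMod.finEquiv t).symm ((j : ℕ) : ZMod t) = j := by
    intro j; rw [natCast_val_eq_zmodFinEquiv, RingEquiv.symm_apply_apply]
  simp only [hj]
  ring

/-- **The `2 : 1` time covering, summed**: `Σ_{x ∈ L³×2t} g(π x) = 2 Σ_{x' ∈ L³×t} g(x')`, `π` = projection of the
canonical representative (each site of the short torus has exactly two preimages). -/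
theorem sum_comp_timeDouble {L t : ℕ} [NeZero L] [NeZero t] [NeZero (2 * t)] (g : FinTorusSite L L L t → ℝ) :
    ∑ x : FinTorusSite L L L (2 * t), g (finTorusProjSite L t (finTorusRepr x)) =
      2 * ∑ x' : FinTorusSite L L L t, g x' := by
  simp only [finTorusProjSite_finTorusRepr_double, Fintype.sum_prod_type, Finset.mul_sum]
  refine Finset.sum_congr rfl fun a _ => Finset.sum_congr rfl fun b _ => Finset.sum_congr rfl fun c _ => ?_
  rw [← Finset.mul_sum]
  exact sum_fin_two_mul_comp fun j => g (a, b, c, j)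

end Sums

end Summit.QuantumFields.YangMills.Cruxes.IR.ColdPurityDobrushin

end
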